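import Summits.BirchSwinnertonDyer.Rank1Residual.GaloisImage.LocalThreeTorsionTriplingCheck
import Summits.BirchSwinnertonDyer.Rank1Residual.GaloisImage.FormalGroupSharpDivisionPadic
import Summits.BirchSwinnertonDyer.Rank1Residual.GaloisImage.LocalThreeTorsionCount
import Summits.BirchSwinnertonDyer.Rank1Residual.GaloisImage.PadicSquareClass
import Literature.NumberTheory.EllipticCurves.ReductionHomomorphism
import HarnessLib

/-!
# The TRIPLING TEST `Σ-TRI`, part 2: a kernel CERTIFIER of the `σ = E0` datum of THEOREM B —
# a `ℚ₃`-rational `3`-torsion point of NONSINGULAR reduction from `sigmaTriCheck = true`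
# (cell `b2b-bsdres`, team n1011, ROW T-SIG3-TRI = r1 ROUTE-1 §46.5 ST-46a; seat p09 GEN 12)

HONEST FRAMING (cell `b2b-bsdres`, run/shared/lean/b2b/bsd-rank1-residual/, verbatim in every
file): the goal of the cell is to DELETE the COMBINATION-SHAPED residual classes of the
Birch–Swinnerton-Dyer formula for ALL analytic-rank `≤ 1` elliptic curves over `ℚ` — "full BSD
formula for every rank `≤ 1` curve in class `C`" assembled STRICTLY from published theorems — so
that the rank-`≤ 1` remainder becomes exactly the CONSTRUCTION-SHAPED classes, which are TYPED
(missing-input `Prop`s), NOT attempted. This is not "finishing BSD". Team n1011 (N10/N11 = X4 ∧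
`p = 3`, research route on the CONSTRUCTION-SHAPED class X4, §I N11). THIS FILE IS A TOOL:
theorems only (no definition, no named fact, no `sorry`); it closes nothing by itself, books
nothing, moves no mark / label / count.

## What

Part 1 (`LocalThreeTorsionTriplingCheck`) defines the computable `sigmaTriCheckAt` /
`sigmaTriCheck` and proves Hensel in `y`. THIS FILE is the kernel form of the (⇐) half of r1's
LEMMA Σ (ROUTE-1 §46.2) — the half the THEOREM-B records need — and it needs NO cuspidality,
NO Lang, NO `E₁[3] = 0` and NO "`D` permutes `𝔽₃`" (those enter only the completeness half,
r1 ST-46f, banked):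

* §1 the `ℤ₃`-model `V₀.map (Int.castRingHom ℤ_[3])` of an integer model `V₀` and its base
  change to `ℚ₃` (no definition, no notation), cast lemmas for `Ψ₃`, `preΨ₄`, `φ₃`; `E₁(ℚ₃)` in
  the two languages of the tree (`reducesToZero_of_isInReductionKernel`);
* §2 **`exists_nonsingular_threeTorsion_of_sigmaTriCheckAt`** /
  **`exists_nonsingular_threeTorsion_of_sigmaTriCheck`** (and the `V₀`-forms `…At'`, `…'`):
  from `Δ ≠ 0` and the check,
  `∃ a b : ℤ_[3]`, `(ā, b̄)` is a NONSINGULAR point of the reduced cubic and `(a, b)` is a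
  `ℚ₃`-point with `(3 : ℤ) • (a, b) = 0`. PROOF: Hensel ⇒ `Q = (x₀, y) ∈ E₀ ∖ E₁`
  (`hasNonsingularReduction_some_algebraMap_iff`); if `Ψ₃(x₀) = 0` then `3Q = O`
  (`LocalTorsion3.three_nsmul_some_eq_zero_iff_eval_Ψ₃`); else `x(3Q) = Φ₃/Ψ₃²`
  (`Affine.Point.zsmul_some_eq_some_φ_div`), `‖x(3Q)‖ = 3^(2v(Ψ₃) − v(Φ₃)) ≥ 3⁴`
  (`PadicSquareClass.norm_intCast_padic_eq`), so `3Q ∈ E⁽²⁾(ℚ₃)` (`norm_formalParameter_sq`,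
  `mem_formalFiltration_iff`) `= 3·E⁽¹⁾(ℚ₃)` (p09 GEN 10
  `LocalDivisibility.map_nsmul_formalFiltration_one_eq_two`, `p ≠ 2`): `3R = 3Q` with `R ∈ E₁`;
  `T := Q − R` has `3T = O`, lies in `E₀` (`HasNonsingularReduction.add/.neg`, AEC VII.2.1) and
  not in `E₁` (else `Q = T + R ∈ E₁`, `ReducesToZero.add`), hence (`point_cases`) has integral
  coordinates of nonsingular reduction;
* §3 pilot: the `σ = E0` datum of 2601h1 (r1's suggested first THEOREM-B row) in the kernel.

The transport to 8b's exact binders (`v₀.adicCompletionIntegers ℚ`, `AlgebraicClosure`) is the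
separate S-sized part 3 (r1 ST-46a′), written against 8b's landed text.

## References (provenance; nothing is cited as a fact)

* [SilvermanAEC2009] J. H. Silverman, *The Arithmetic of Elliptic Curves*, 2nd ed.: Ex. 3.7(d),(f)
  (division polynomials), IV.3.2, Thm. IV.6.4(b), Prop. VII.2.1, VII.2.2.
* r1 ROUTE-1 §46 (`cells/n1011/ROUTE-1.md`, `route1/g34_S46.md`): LEMMA Σ and the census P46-a/b
  (EVIDENCE: 51 126 / 51 126 additive curves; never a Literature fact).
-/

set_option autoImplicit false

noncomputable section

open scoped Classical
open Polynomial WeierstrassCurve Literature.NumberTheory.EllipticCurves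

namespace Summit.BirchSwinnertonDyer.Rank1Residual.GaloisImage.SigmaTri

/-! ### §1. `E₁(ℚ₃)` in two languages; the `ℤ₃`-model and the cast lemmas -/

/-- `E₁(ℚ₃)` in the two languages: a point in the kernel of reduction in the sense of
`FormalGroup.lean` (`‖x‖ > 1`) reduces to `Õ` in the sense of `ReductionHomomorphism.lean`
(`x ∉ ℤ₃`). [folklore] -/
theorem reducesToZero_of_isInReductionKernel (V : WeierstrassCurve ℤ_[3])
    {P : (V.baseChange ℚ_[3]).toAffine.Point} (h : (V.baseChange ℚ_[3]).IsInReductionKernel P) :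
    V.ReducesToZero P := by
  rcases P with _ | ⟨x, y, hxy⟩
  · exact reducesToZero_zero
  · rw [reducesToZero_some_iff]
    rw [isInReductionKernel_some] at h
    rintro ⟨z, rfl⟩
    exact absurd h (not_lt.mpr (PadicInt.norm_le_one z))

section TriplingTest

variable (V₀ : WeierstrassCurve ℤ)

/-- The `ℤ₃`-model has the cast coefficients. -/
private theorem V_eq : V₀.map (Int.castRingHom ℤ_[3]) =
    ⟨(V₀.a₁ : ℤ_[3]), (V₀.a₂ : ℤ_[3]), (V₀.a₃ : ℤ_[3]), (V₀.a₄ : ℤ_[3]), (V₀.a₆ : ℤ_[3])⟩ := by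
  ext <;> simp [WeierstrassCurve.map]

/-- The curve over `ℚ₃` has the cast coefficients. -/
private theorem E_eq : (V₀.map (Int.castRingHom ℤ_[3])).baseChange ℚ_[3] =
    ⟨(V₀.a₁ : ℚ_[3]), (V₀.a₂ : ℚ_[3]), (V₀.a₃ : ℚ_[3]), (V₀.a₄ : ℚ_[3]), (V₀.a₆ : ℚ_[3])⟩ := by
  ext <;> simp [WeierstrassCurve.baseChange, WeierstrassCurve.map]

/-- The curve over `ℚ₃` is `3`-integral (it IS a base change from `ℤ₃`). -/
private theorem E_isIntegral :
    ((V₀.map (Int.castRingHom ℤ_[3])).baseChange ℚ_[3]).IsIntegral ℤ_[3] :=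
  ⟨V₀.map (Int.castRingHom ℤ_[3]), rfl⟩

/-- The discriminant over `ℚ₃` is the cast of the integer discriminant. -/
private theorem E_Δ :
    ((V₀.map (Int.castRingHom ℤ_[3])).baseChange ℚ_[3]).Δ = ((V₀.Δ : ℤ) : ℚ_[3]) := by
  simp only [WeierstrassCurve.baseChange, WeierstrassCurve.map_map, WeierstrassCurve.map_Δ,
    eq_intCast]

/-- `Δ ≠ 0` over `ℤ` makes the curve over `ℚ₃` elliptic. -/
private theorem E_isElliptic (hΔ : V₀.Δ ≠ 0) :
    ((V₀.map (Int.castRingHom ℤ_[3])).baseChange ℚ_[3]).IsElliptic :=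
  ⟨isUnit_iff_ne_zero.mpr (by rw [E_Δ]; exact_mod_cast hΔ)⟩

/-- `Ψ₃` of the curve at an integer is the integer `psi3Int`. -/
private theorem eval_Ψ₃_intCast (x : ℤ) :
    ((V₀.map (Int.castRingHom ℤ_[3])).baseChange ℚ_[3]).Ψ₃.eval (x : ℚ_[3]) =
      (psi3Int V₀.a₁ V₀.a₂ V₀.a₃ V₀.a₄ V₀.a₆ x : ℚ_[3]) := by
  rw [Additive.eval_psi3_eq, E_eq]
  simp only [psi3Int, WeierstrassCurve.b₂, WeierstrassCurve.b₄, WeierstrassCurve.b₆,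
    WeierstrassCurve.b₈]
  push_cast
  ring

/-- `preΨ₄` of the curve at an integer is the integer `prePsi4Int`. -/
private theorem eval_preΨ₄_intCast (x : ℤ) :
    ((V₀.map (Int.castRingHom ℤ_[3])).baseChange ℚ_[3]).preΨ₄.eval (x : ℚ_[3]) =
      (prePsi4Int V₀.a₁ V₀.a₂ V₀.a₃ V₀.a₄ V₀.a₆ x : ℚ_[3]) := by
  rw [E_eq]
  simp only [WeierstrassCurve.preΨ₄, eval_add, eval_mul, eval_pow, eval_C, eval_X, eval_ofNat,
    prePsi4Int, WeierstrassCurve.b₂, WeierstrassCurve.b₄, WeierstrassCurve.b₆, WeierstrassCurve.b₈]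
  push_cast
  ring

/-- `φ₃(x, y) = x·Ψ₃(x)² − preΨ₄(x)·(2y + a₁x + a₃)²` (Mathlib `φ_three`), and on the curve
`(2y + a₁x + a₃)² = 4x³ + b₂x² + 2b₄x + b₆`: at an integer `x`, `φ₃ = phi3Int`.
[cite: SilvermanAEC2009, Exercise 3.7(d)] -/
private theorem evalEval_φ_three_intCast (x : ℤ) {y : ℚ_[3]}
    (heq : ((V₀.map (Int.castRingHom ℤ_[3])).baseChange ℚ_[3]).toAffine.Equation (x : ℚ_[3]) y) :
    (((V₀.map (Int.castRingHom ℤ_[3])).baseChange ℚ_[3]).φ 3).evalEval (x : ℚ_[3]) y =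
      (phi3Int V₀.a₁ V₀.a₂ V₀.a₃ V₀.a₄ V₀.a₆ x : ℚ_[3]) := by
  have hsq := (LocalTorsion3.equation_iff_sq_eq_g
    ((V₀.map (Int.castRingHom ℤ_[3])).baseChange ℚ_[3]) (by norm_num) _ _).mp heq
  rw [WeierstrassCurve.φ_three]
  simp only [evalEval_sub, evalEval_mul, evalEval_pow, evalEval_C, eval_X, WeierstrassCurve.ψ₂,
    Affine.evalEval_polynomialY]
  rw [eval_Ψ₃_intCast, eval_preΨ₄_intCast, hsq, E_eq]
  simp only [phi3Int, gInt, WeierstrassCurve.b₂, WeierstrassCurve.b₄, WeierstrassCurve.b₆]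
  push_cast
  ring

/-! ### §2. The END: a `3`-torsion point of nonsingular reduction from the tripling test -/

/-- **Σ-TRI, pointed form, for an integer model `V₀`.** With `Δ ≠ 0` and a residue pair
`(x₀, y₀)` passing `sigmaTriCheckAt`, the curve has a point `(a, b)`, `a, b ∈ ℤ₃`, whose reduction
`(ā, b̄)` is a NONSINGULAR point of the reduced cubic over the residue field of `ℤ₃` and with
`3 · (a, b) = O` in `E(ℚ₃)` — the `σ = E0` datum of THEOREM B. (The (⇐) half of r1's LEMMA Σ;
no reduction-type hypothesis.) [cite: SilvermanAEC2009, VII.2 Prop. 2.1 (PDF p. 167)]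
[cite: SilvermanAEC2009, Thm. IV.6.4] [cite: SilvermanAEC2009, Exercise 3.7(d)] -/
theorem exists_nonsingular_threeTorsion_of_sigmaTriCheckAt' (hΔ : V₀.Δ ≠ 0) {x₀ y₀ : ℤ}
    (h : sigmaTriCheckAt V₀.a₁ V₀.a₂ V₀.a₃ V₀.a₄ V₀.a₆ x₀ y₀ = true) :
    ∃ a b : ℤ_[3],
      ((V₀.map (Int.castRingHom ℤ_[3])).map (IsLocalRing.residue ℤ_[3])).toAffine.Nonsingular
        (IsLocalRing.residue ℤ_[3] a) (IsLocalRing.residue ℤ_[3] b) ∧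
      ∃ hns : ((V₀.map (Int.castRingHom ℤ_[3])).baseChange ℚ_[3]).toAffine.Nonsingular
          (a : ℚ_[3]) (b : ℚ_[3]),
        (3 : ℤ) • (Affine.Point.some _ _ hns) = 0 := by
  -- unpack the checker
  simp only [sigmaTriCheckAt, Bool.and_eq_true, Bool.or_eq_true, beq_iff_eq, Bool.not_eq_true',
    beq_eq_false_iff_ne, ne_eq, RootCensus.emod_eq_zero_iff_dvd', decide_eq_true_eq] at h
  obtain ⟨⟨hF, hFy⟩, hdepth⟩ := h
  -- the curve and the valuation data
  haveI : Fact (Nat.Prime 3) := ⟨Nat.prime_three⟩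
  haveI : ((V₀.map (Int.castRingHom ℤ_[3])).baseChange ℚ_[3]).IsElliptic := E_isElliptic V₀ hΔ
  haveI : ((V₀.map (Int.castRingHom ℤ_[3])).baseChange ℚ_[3]).IsIntegral ℤ_[3] := E_isIntegral V₀
  have hv := padicInt_valuationIntegers_three
  have hinj : Function.Injective (algebraMap ℤ_[3] ℚ_[3]) := hv.hom_inj
  -- §3: the point `Q = (x₀, y)`
  obtain ⟨y, hy, hunit, -⟩ :=
    exists_padicInt_root_y V₀.a₁ V₀.a₂ V₀.a₃ V₀.a₄ V₀.a₆ x₀ y₀ hF hFy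
  have heqZ : (V₀.map (Int.castRingHom ℤ_[3])).toAffine.Equation (x₀ : ℤ_[3]) y := by
    rw [Affine.equation_iff', V_eq]
    rw [← hy]
    push_cast
    ring
  have heq : ((V₀.map (Int.castRingHom ℤ_[3])).baseChange ℚ_[3]).toAffine.Equation
      (algebraMap ℤ_[3] ℚ_[3] (x₀ : ℤ_[3])) (algebraMap ℤ_[3] ℚ_[3] y) :=
    heqZ.map (algebraMap ℤ_[3] ℚ_[3])
  have hns : ((V₀.map (Int.castRingHom ℤ_[3])).baseChange ℚ_[3]).toAffine.Nonsingular
      (algebraMap ℤ_[3] ℚ_[3] (x₀ : ℤ_[3])) (algebraMap ℤ_[3] ℚ_[3] y) :=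
    (Affine.equation_iff_nonsingular).mp heq
  have hres : ((V₀.map (Int.castRingHom ℤ_[3])).map
      (IsLocalRing.residue ℤ_[3])).toAffine.Nonsingular
      (IsLocalRing.residue ℤ_[3] (x₀ : ℤ_[3])) (IsLocalRing.residue ℤ_[3] y) := by
    rw [Affine.nonsingular_iff']
    refine ⟨heqZ.map (IsLocalRing.residue ℤ_[3]), Or.inr ?_⟩
    have hu : IsUnit (2 * y + (V₀.a₁ : ℤ_[3]) * (x₀ : ℤ_[3]) + (V₀.a₃ : ℤ_[3])) := by
      rw [PadicInt.isUnit_iff, show 2 * y + (V₀.a₁ : ℤ_[3]) * (x₀ : ℤ_[3]) + (V₀.a₃ : ℤ_[3]) =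
        2 * y + ((V₀.a₁ * x₀ + V₀.a₃ : ℤ) : ℤ_[3]) by push_cast; ring]
      exact hunit
    have hne := (IsLocalRing.residue_ne_zero_iff_isUnit _).mpr hu
    simpa [V_eq, map_add, map_mul, map_ofNat] using hne
  set Q : ((V₀.map (Int.castRingHom ℤ_[3])).baseChange ℚ_[3]).toAffine.Point :=
    Affine.Point.some _ _ hns with hQdef
  have hQ0 : (V₀.map (Int.castRingHom ℤ_[3])).HasNonsingularReduction Q :=
    (hasNonsingularReduction_some_algebraMap_iff hinj hns).mpr hres
  have hQ1 : ¬ (V₀.map (Int.castRingHom ℤ_[3])).ReducesToZero Q := by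
    rw [hQdef, reducesToZero_some_iff]; exact not_not.mpr ⟨_, rfl⟩
  have hxq : algebraMap ℤ_[3] ℚ_[3] (x₀ : ℤ_[3]) = ((x₀ : ℤ) : ℚ_[3]) := by simp
  rcases hdepth with hΨ0 | ⟨hΦ0, hval⟩
  · -- `Ψ₃(x₀) = 0`: `Q` itself is `3`-torsion
    have h3 : (3 : ℕ) • Q = 0 := by
      refine (LocalTorsion3.three_nsmul_some_eq_zero_iff_eval_Ψ₃
        ((V₀.map (Int.castRingHom ℤ_[3])).baseChange ℚ_[3]) hns).mpr ?_
      rw [hxq, eval_Ψ₃_intCast, hΨ0, Int.cast_zero]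
    refine ⟨(x₀ : ℤ_[3]), y, hres, hns, ?_⟩
    rw [show (3 : ℤ) = ((3 : ℕ) : ℤ) from rfl, natCast_zsmul]
    exact h3
  · -- `Ψ₃(x₀) ≠ 0`: `3Q = (Φ₃/Ψ₃², *)` lies in `E⁽²⁾ = 3 E⁽¹⁾`
    have hΨ0 : psi3Int V₀.a₁ V₀.a₂ V₀.a₃ V₀.a₄ V₀.a₆ x₀ ≠ 0 := by
      intro h0; rw [h0] at hval; simp [val3, val3Aux] at hval
    have hψ : (((V₀.map (Int.castRingHom ℤ_[3])).baseChange ℚ_[3]).ψ 3).evalEval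
        (algebraMap ℤ_[3] ℚ_[3] (x₀ : ℤ_[3])) (algebraMap ℤ_[3] ℚ_[3] y) ≠ 0 := by
      rw [WeierstrassCurve.ψ_three, evalEval_C, hxq, eval_Ψ₃_intCast]
      exact_mod_cast hΨ0
    obtain ⟨y₁, hns₁, h3Q⟩ := Affine.Point.zsmul_some_eq_some_φ_div hns (n := 3) hψ
    -- the `x`-coordinate `x₁` of `3Q` and its norm
    set x₁ : ℚ_[3] := (((V₀.map (Int.castRingHom ℤ_[3])).baseChange ℚ_[3]).φ 3).evalEval
        (algebraMap ℤ_[3] ℚ_[3] (x₀ : ℤ_[3])) (algebraMap ℤ_[3] ℚ_[3] y) /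
      (((V₀.map (Int.castRingHom ℤ_[3])).baseChange ℚ_[3]).ψ 3).evalEval
        (algebraMap ℤ_[3] ℚ_[3] (x₀ : ℤ_[3])) (algebraMap ℤ_[3] ℚ_[3] y) ^ 2 with hx₁def
    have hx₁ : x₁ = (phi3Int V₀.a₁ V₀.a₂ V₀.a₃ V₀.a₄ V₀.a₆ x₀ : ℚ_[3]) /
        (psi3Int V₀.a₁ V₀.a₂ V₀.a₃ V₀.a₄ V₀.a₆ x₀ : ℚ_[3]) ^ 2 := by
      rw [hx₁def]
      rw [WeierstrassCurve.ψ_three, evalEval_C, hxq, eval_Ψ₃_intCast,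
        evalEval_φ_three_intCast V₀ x₀ (by rw [← hxq]; exact heq)]
    have hnΦ : ‖(phi3Int V₀.a₁ V₀.a₂ V₀.a₃ V₀.a₄ V₀.a₆ x₀ : ℚ_[3])‖ =
        (3 : ℝ) ^ (-(val3 (phi3Int V₀.a₁ V₀.a₂ V₀.a₃ V₀.a₄ V₀.a₆ x₀) : ℤ)) := by
      have := PadicSquareClass.norm_intCast_padic_eq (p := 3)
        (by exact_mod_cast pow_val3_dvd (phi3Int V₀.a₁ V₀.a₂ V₀.a₃ V₀.a₄ V₀.a₆ x₀))
        (by exact_mod_cast not_pow_val3_succ_dvd hΦ0)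
      exact_mod_cast this
    have hnΨ : ‖(psi3Int V₀.a₁ V₀.a₂ V₀.a₃ V₀.a₄ V₀.a₆ x₀ : ℚ_[3])‖ =
        (3 : ℝ) ^ (-(val3 (psi3Int V₀.a₁ V₀.a₂ V₀.a₃ V₀.a₄ V₀.a₆ x₀) : ℤ)) := by
      have := PadicSquareClass.norm_intCast_padic_eq (p := 3)
        (by exact_mod_cast pow_val3_dvd (psi3Int V₀.a₁ V₀.a₂ V₀.a₃ V₀.a₄ V₀.a₆ x₀))
        (by exact_mod_cast not_pow_val3_succ_dvd hΨ0)
      exact_mod_cast this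
    have hnorm : (81 : ℝ) ≤ ‖(phi3Int V₀.a₁ V₀.a₂ V₀.a₃ V₀.a₄ V₀.a₆ x₀ : ℚ_[3]) /
        (psi3Int V₀.a₁ V₀.a₂ V₀.a₃ V₀.a₄ V₀.a₆ x₀ : ℚ_[3]) ^ 2‖ := by
      rw [norm_div, norm_pow, hnΦ, hnΨ, ← zpow_natCast, ← zpow_mul, ← zpow_sub₀ (by norm_num)]
      rw [show (81 : ℝ) = (3 : ℝ) ^ (4 : ℤ) by norm_num]
      exact zpow_le_zpow_right₀ (by norm_num) (by push_cast; omega)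
    have h1lt : 1 < ‖x₁‖ := by
      rw [hx₁]; exact lt_of_lt_of_le (by norm_num) hnorm
    -- `3Q ∈ E⁽²⁾(ℚ₃)`
    have hK : ((V₀.map (Int.castRingHom ℤ_[3])).baseChange ℚ_[3]).IsInReductionKernel
        ((3 : ℤ) • Q) := by
      rw [h3Q]; exact (isInReductionKernel_some _ hns₁).mpr h1lt
    have hz : ‖((V₀.map (Int.castRingHom ℤ_[3])).baseChange ℚ_[3]).formalParameter ((3 : ℤ) • Q)‖ ≤
        ((3 : ℝ)⁻¹) ^ 2 := by
      rw [h3Q, formalParameter_some]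
      have hsq := ((V₀.map (Int.castRingHom ℤ_[3])).baseChange ℚ_[3]).norm_formalParameter_sq
        hns₁.left h1lt
      have hle : ‖-x₁ / y₁‖ ^ 2 ≤ (((3 : ℝ)⁻¹) ^ 2) ^ 2 := by
        rw [hsq, hx₁, show (((3 : ℝ)⁻¹) ^ 2) ^ 2 = (81 : ℝ)⁻¹ by norm_num]
        exact inv_anti₀ (by norm_num) hnorm
      exact (pow_le_pow_iff_left₀ (norm_nonneg _) (by positivity) two_ne_zero).mp hle
    have hmem2 : (3 : ℤ) • Q ∈
        ((V₀.map (Int.castRingHom ℤ_[3])).baseChange ℚ_[3]).formalFiltration 2 := by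
      refine (mem_formalFiltration_iff _).mpr ⟨hK, ?_⟩
      simpa using hz
    -- `E⁽²⁾ = 3 · E⁽¹⁾` (p09 GEN 10): `3R = 3Q` with `R ∈ E₁`
    have hmap := LocalDivisibility.map_nsmul_formalFiltration_one_eq_two
      ((V₀.map (Int.castRingHom ℤ_[3])).baseChange ℚ_[3]) (show (3 : ℕ) ≠ 2 by decide)
    have h3Qn : (3 : ℕ) • Q ∈ (((V₀.map (Int.castRingHom ℤ_[3])).baseChange
        ℚ_[3]).formalFiltration 1).map (nsmulAddMonoidHom 3) := by
      rw [hmap, ← natCast_zsmul]; exact hmem2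
    obtain ⟨R, hR1, hR3⟩ := AddSubgroup.mem_map.mp h3Qn
    rw [nsmulAddMonoidHom_apply] at hR3
    have hRz : (V₀.map (Int.castRingHom ℤ_[3])).ReducesToZero R :=
      reducesToZero_of_isInReductionKernel _ ((mem_formalFiltration_iff _).mp hR1).1
    -- `T = Q - R`
    have hT3 : (3 : ℕ) • (Q - R) = 0 := by rw [nsmul_sub, hR3, sub_self]
    have hT0 : (V₀.map (Int.castRingHom ℤ_[3])).HasNonsingularReduction (Q - R) := by
      rw [sub_eq_add_neg]; exact hQ0.add hv hRz.neg.hasNonsingularReduction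
    have hT1 : ¬ (V₀.map (Int.castRingHom ℤ_[3])).ReducesToZero (Q - R) := fun hT => hQ1 (by
      have := hT.add hv hRz; rwa [sub_add_cancel] at this)
    rcases point_cases hv (Q - R) with h0 | ⟨x, y', hxy, hP, hx⟩ | ⟨a, b, hab, hP⟩
    · rw [h0] at hT1; exact absurd reducesToZero_zero hT1
    · exact absurd ((reducesToZero_some_iff hxy).mpr ((not_mem_range_iff hv).mpr hx)) (hP ▸ hT1)
    · have hres' := (hasNonsingularReduction_some_algebraMap_iff hinj hab).mp (hP ▸ hT0)
      refine ⟨a, b, hres', hab, ?_⟩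
      rw [show (3 : ℤ) = ((3 : ℕ) : ℤ) from rfl, natCast_zsmul]
      rw [hP] at hT3
      exact hT3

/-- **Σ-TRI for an integer model `V₀`.** `sigmaTriCheck V₀.a₁ … V₀.a₆ = true` and `Δ ≠ 0` give a
`ℚ₃`-point `(a, b)`, `a, b ∈ ℤ₃`, of NONSINGULAR reduction with `3 · (a, b) = O`.
[cite: SilvermanAEC2009, VII.2 Prop. 2.1 (PDF p. 167)] [cite: SilvermanAEC2009, Thm. IV.6.4] -/
theorem exists_nonsingular_threeTorsion_of_sigmaTriCheck' (hΔ : V₀.Δ ≠ 0)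
    (h : sigmaTriCheck V₀.a₁ V₀.a₂ V₀.a₃ V₀.a₄ V₀.a₆ = true) :
    ∃ a b : ℤ_[3],
      ((V₀.map (Int.castRingHom ℤ_[3])).map (IsLocalRing.residue ℤ_[3])).toAffine.Nonsingular
        (IsLocalRing.residue ℤ_[3] a) (IsLocalRing.residue ℤ_[3] b) ∧
      ∃ hns : ((V₀.map (Int.castRingHom ℤ_[3])).baseChange ℚ_[3]).toAffine.Nonsingular
          (a : ℚ_[3]) (b : ℚ_[3]),
        (3 : ℤ) • (Affine.Point.some _ _ hns) = 0 := by
  simp only [sigmaTriCheck, List.any_cons, List.any_nil, Bool.or_false, Bool.or_eq_true] at h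
  rcases h with (h | h | h) | (h | h | h) | (h | h | h) <;>
    exact exists_nonsingular_threeTorsion_of_sigmaTriCheckAt' V₀ hΔ h

end TriplingTest

/-- **Σ-TRI, pointed form** (record binder shape `a₁ … a₆`): for integers `a₁, …, a₆` with
`Δ ≠ 0` and a residue pair `(x₀, y₀)` passing `sigmaTriCheckAt`, the curve
`y² + a₁xy + a₃y = x³ + a₂x² + a₄x + a₆` has a `ℚ₃`-point `(a, b)`, `a, b ∈ ℤ₃`, of NONSINGULAR
reduction with `3 · (a, b) = O`. [cite: SilvermanAEC2009, VII.2 Prop. 2.1 (PDF p. 167)]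
[cite: SilvermanAEC2009, Thm. IV.6.4] -/
theorem exists_nonsingular_threeTorsion_of_sigmaTriCheckAt (a₁ a₂ a₃ a₄ a₆ : ℤ)
    (hΔ : (⟨a₁, a₂, a₃, a₄, a₆⟩ : WeierstrassCurve ℤ).Δ ≠ 0) {x₀ y₀ : ℤ}
    (h : sigmaTriCheckAt a₁ a₂ a₃ a₄ a₆ x₀ y₀ = true) :
    ∃ a b : ℤ_[3],
      (((⟨a₁, a₂, a₃, a₄, a₆⟩ : WeierstrassCurve ℤ).map (Int.castRingHom ℤ_[3])).map
          (IsLocalRing.residue ℤ_[3])).toAffine.Nonsingular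
        (IsLocalRing.residue ℤ_[3] a) (IsLocalRing.residue ℤ_[3] b) ∧
      ∃ hns : (((⟨a₁, a₂, a₃, a₄, a₆⟩ : WeierstrassCurve ℤ).map (Int.castRingHom ℤ_[3])).baseChange
          ℚ_[3]).toAffine.Nonsingular (a : ℚ_[3]) (b : ℚ_[3]),
        (3 : ℤ) • (Affine.Point.some _ _ hns) = 0 :=
  exists_nonsingular_threeTorsion_of_sigmaTriCheckAt' ⟨a₁, a₂, a₃, a₄, a₆⟩ hΔ h

/-- **Σ-TRI** (record binder shape `a₁ … a₆`): for integers `a₁, …, a₆` with `Δ ≠ 0` and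
`sigmaTriCheck a₁ … a₆ = true` (`decide` per record), the curve has a `ℚ₃`-point `(a, b)`,
`a, b ∈ ℤ₃`, of NONSINGULAR reduction with `3 · (a, b) = O`.
[cite: SilvermanAEC2009, VII.2 Prop. 2.1 (PDF p. 167)] [cite: SilvermanAEC2009, Thm. IV.6.4] -/
theorem exists_nonsingular_threeTorsion_of_sigmaTriCheck (a₁ a₂ a₃ a₄ a₆ : ℤ)
    (hΔ : (⟨a₁, a₂, a₃, a₄, a₆⟩ : WeierstrassCurve ℤ).Δ ≠ 0)
    (h : sigmaTriCheck a₁ a₂ a₃ a₄ a₆ = true) :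
    ∃ a b : ℤ_[3],
      (((⟨a₁, a₂, a₃, a₄, a₆⟩ : WeierstrassCurve ℤ).map (Int.castRingHom ℤ_[3])).map
          (IsLocalRing.residue ℤ_[3])).toAffine.Nonsingular
        (IsLocalRing.residue ℤ_[3] a) (IsLocalRing.residue ℤ_[3] b) ∧
      ∃ hns : (((⟨a₁, a₂, a₃, a₄, a₆⟩ : WeierstrassCurve ℤ).map (Int.castRingHom ℤ_[3])).baseChange
          ℚ_[3]).toAffine.Nonsingular (a : ℚ_[3]) (b : ℚ_[3]),
        (3 : ℤ) • (Affine.Point.some _ _ hns) = 0 :=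
  exists_nonsingular_threeTorsion_of_sigmaTriCheck' ⟨a₁, a₂, a₃, a₄, a₆⟩ hΔ h

/-! ### §3. Pilot: the `σ = E0` datum of 2601h1 (r1 ROUTE-1 §46.5 ST-46b) in the kernel -/

/-- **The `σ = E0` datum of 2601h1 at `3`, in the kernel**: a `ℚ₃`-rational `3`-torsion point of
nonsingular reduction on `[1, -1, 0, -59877, -3934008]`. [folklore] -/
theorem exists_nonsingular_threeTorsion_2601h1 :
    ∃ a b : ℤ_[3],
      (((⟨1, -1, 0, -59877, -3934008⟩ : WeierstrassCurve ℤ).map (Int.castRingHom ℤ_[3])).map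
          (IsLocalRing.residue ℤ_[3])).toAffine.Nonsingular
        (IsLocalRing.residue ℤ_[3] a) (IsLocalRing.residue ℤ_[3] b) ∧
      ∃ hns : (((⟨1, -1, 0, -59877, -3934008⟩ : WeierstrassCurve ℤ).map
          (Int.castRingHom ℤ_[3])).baseChange ℚ_[3]).toAffine.Nonsingular (a : ℚ_[3]) (b : ℚ_[3]),
        (3 : ℤ) • (Affine.Point.some _ _ hns) = 0 :=
  exists_nonsingular_threeTorsion_of_sigmaTriCheck 1 (-1) 0 (-59877) (-3934008) (by decide)
    sigmaTriCheck_2601h1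

end Summit.BirchSwinnertonDyer.Rank1Residual.GaloisImage.SigmaTri

end
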